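import Summits.ResolutionOfSingularities.ResolutionOfSingularities.Theorems.FrobeniusLadderFRationalResolutionGaloisStableCentre
import Summits.ResolutionOfSingularities.ResolutionOfSingularities.Theorems.FrobeniusLadderFRationalResolutionBlowupOrbitCentre
import Summits.ResolutionOfSingularities.ResolutionOfSingularities.Theorems.FrobeniusLadderFRationalResolutionGaloisTwistInvariants
import HarnessLib

/-!
# Crux `FrobeniusLadder.FRationalResolution` (stmt-ResolutionOfSingularities-15317), line `redirect`,
# stub `stub_diagonalizableQuotientResolution` — THE GALOIS ROUTE, SCHEME SIDE, IN ONE STATEMENT: resolution of an isolated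
# singular point from ONE primary piece at ONE point of `B ⊗_K K'` over `𝔭`, stable under its decomposition group

Assembly of this generation's bricks (`…GaloisIdealDescent` ✓ p832843, `…GaloisStableCentre` ✓ p832950, `…BlowupRegularZariskiLocal`
✓ p833027, `…BlowupComaximalCentres` ✓ p833109, `…BlowupOrbitCentre` ✓ p833192, `…GaloisTwistInvariants`): at an isolated singular
point `ι 𝔭` of `X` (affine open `Spec B`), given a finite Galois `K'/K`, ONE maximal `𝔔'` of `B' := B ⊗_K K'` over `𝔭`, and a
`𝔔'`-primary piece `I` (`𝔔'ⁿ ⊆ I ⊆ 𝔔'`) which is STABLE UNDER THE DECOMPOSITION GROUP (`(1 ⊗ σ)𝔔' = 𝔔' ⇒ (1 ⊗ σ) I ≤ I`) and has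
`Bl_{I B'_g}` regular for some `g ∉ 𝔔'`, with `Spec B'` regular at the primes not over `𝔭`: the orbit centre `⨅_σ (1 ⊗ σ) I` is
Galois-stable, covers EVERY point over `𝔭` (transitivity), has regular blow-up (orbit centre theorem), descends to `B` (Galois
descent) and resolves `ι 𝔭` (`…ChartHloc`).

* `hloc_of_decomposition_stable_piece` — the local resolution datum at `ι 𝔭`;
* **`hasResolution_of_decomposition_stable_pieces`** — finitely many singular points, each with such data ⇒ `Scheme.HasResolution X`.

Honest label: assembly (no stub closed by name). THE REMAINING OBLIGATION of the Galois route for the isolated twisted case of the stub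
is now exactly the hypothesis list of `hloc_of_decomposition_stable_piece` at one point: produce `K'`, `𝔔'`, and a decomposition-stable
primary piece with locally regular blow-up (memo MEMO-15317-leafhand4-g7 §3–§4: field part ✓ `…ResidueSeparableCapture`; the
decomposition-stability is the comparison of two chart structures at one point). No definitions, no named facts, no sorry.
[cite: StacksProject, Tag 0CDQ; Tag 09EB; Tag 02OS] [cite: Kollar2007, §2.2]
-/

noncomputable section

-- single-problem summit: the doubled namespace component is forced
set_option linter.dupNamespace false

open CategoryTheory AlgebraicGeometry TopologicalSpace TensorProduct
open Literature.AlgebraicGeometry.Resolution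
open Summit.ResolutionOfSingularities.ResolutionOfSingularities.Theorems.FRationalResolution

namespace Summit.ResolutionOfSingularities.ResolutionOfSingularities.Theorems.FRationalResolution.GaloisOrbitAssembly

/-- **`hloc` from ONE decomposition-stable primary piece at ONE point over `𝔭`.** Data: `ι : Spec B → X` an affine open over `K`
(`B` a domain of finite type over `K`, `X` integral locally of finite type), `𝔭 ⊆ B` maximal `≠ 0` with `ι 𝔭` singular and every
other point of `Spec B` regular; `K'/K` finite Galois, `B' := B ⊗_K K'` regular at the primes NOT over `𝔭`; ONE maximal `𝔔' ⊆ B'`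
over `𝔭` and an ideal `I` with `𝔔'ⁿ ⊆ I ⊆ 𝔔'`, `(1 ⊗ σ) I ≤ I` whenever `(1 ⊗ σ) 𝔔' = 𝔔'`, and `Bl_{I B'_g}` regular for some
`g ∉ 𝔔'`. Then `ι 𝔭` has the local resolution datum `hloc`. [cite: StacksProject, Tag 0CDQ; Tag 09EB] [cite: Kollar2007, §2.2] -/
theorem hloc_of_decomposition_stable_piece (K : Type) [Field K] (X : Scheme.{0}) [IsIntegral X]
    (f : X ⟶ Spec (.of K)) [LocallyOfFiniteType f]
    {B : Type} [CommRing B] [IsDomain B] [Algebra K B] [Algebra.FiniteType K B]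
    (ι : Spec (.of B) ⟶ X) [IsOpenImmersion ι] (hι : ι ≫ f = Spec.map (CommRingCat.ofHom (algebraMap K B)))
    (𝔭 : Ideal B) [h𝔭 : 𝔭.IsMaximal] (h𝔭0 : 𝔭 ≠ ⊥)
    (hsing : ι ⟨𝔭, h𝔭.isPrime⟩ ∉ Scheme.regularLocus X)
    (hregB : ∀ P : Spec (.of B), P.asIdeal ≠ 𝔭 → P ∈ Scheme.regularLocus (Spec (.of B)))
    (K' : Type) [Field K'] [Algebra K K'] [FiniteDimensional K K'] [IsGalois K K']
    (hoff : ∀ x : Spec (.of (B ⊗[K] K')), x.asIdeal.comap (algebraMap B (B ⊗[K] K')) ≠ 𝔭 →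
      x ∈ Scheme.regularLocus (Spec (.of (B ⊗[K] K'))))
    (𝔔' : Ideal (B ⊗[K] K')) [h𝔔' : 𝔔'.IsMaximal] (h𝔔'𝔭 : 𝔔'.comap (algebraMap B (B ⊗[K] K')) = 𝔭)
    (I : Ideal (B ⊗[K] K')) {n : ℕ} (hpI : 𝔔' ^ n ≤ I) (hIp : I ≤ 𝔔')
    (hD : ∀ σ : K' ≃ₐ[K] K',
      𝔔'.map (Algebra.TensorProduct.map (AlgHom.id B B) (σ : K' →ₐ[K] K')) = 𝔔' →
      I.map (Algebra.TensorProduct.map (AlgHom.id B B) (σ : K' →ₐ[K] K')) ≤ I)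
    (hreg : ∃ g : B ⊗[K] K', g ∉ 𝔔' ∧
      Scheme.IsRegular (affineBlowup (I.map (algebraMap (B ⊗[K] K') (Localization.Away g))))) :
    ∃ (V : X.Opens), ι ⟨𝔭, h𝔭.isPrime⟩ ∈ V ∧
      (∀ t : X, t ∉ Scheme.regularLocus X → t ∈ V → t = ι ⟨𝔭, h𝔭.isPrime⟩) ∧
      ∃ (Y : Scheme.{0}) (ρ : Y ⟶ V), IsProper ρ ∧ Scheme.IsRegular Y ∧
        IsIso (ρ ∣_ (V.ι ⁻¹ᵁ ⟨Scheme.regularLocus X, isOpen_regularLocus_of_locallyOfFiniteType_field f⟩)) ∧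
        Dense ((ρ ⁻¹ᵁ (V.ι ⁻¹ᵁ ⟨Scheme.regularLocus X,
          isOpen_regularLocus_of_locallyOfFiniteType_field f⟩) : Y.Opens) : Set Y) := by
  classical
  haveI : IsNoetherianRing B := Algebra.FiniteType.isNoetherianRing K B
  haveI : Algebra.FiniteType B (B ⊗[K] K') := inferInstance
  haveI : IsNoetherianRing (B ⊗[K] K') := Algebra.FiniteType.isNoetherianRing B (B ⊗[K] K')
  have h1id : ∀ J' : Ideal (B ⊗[K] K'), J'.map ((1 : RingAut (B ⊗[K] K')) : B ⊗[K] K' →+* B ⊗[K] K') = J' :=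
    fun J' => by rw [show ((1 : RingAut (B ⊗[K] K')) : B ⊗[K] K' →+* B ⊗[K] K') = RingHom.id _ from rfl, Ideal.map_id]
  -- the twist action `act : Gal →* RingAut (B ⊗[K] K')`
  let τ : (K' ≃ₐ[K] K') → (B ⊗[K] K' ≃ₐ[B] B ⊗[K] K') := fun σ => Algebra.TensorProduct.congr (AlgEquiv.refl : B ≃ₐ[B] B) σ
  have hτ : ∀ σ x, τ σ x = Algebra.TensorProduct.map (AlgHom.id B B) (σ : K' →ₐ[K] K') x := by
    intro σ x
    induction x using TensorProduct.induction_on with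
    | zero => simp
    | tmul b y => simp [τ, Algebra.TensorProduct.map_tmul]
    | add x y hx hy => rw [map_add, map_add, hx, hy]
  have hone : ∀ x, τ 1 x = x := by
    intro x
    rw [hτ]
    induction x using TensorProduct.induction_on with
    | zero => simp
    | tmul b y => simp [Algebra.TensorProduct.map_tmul]
    | add x y hx hy => rw [map_add, hx, hy]
  have hmul : ∀ σ σ' x, τ (σ * σ') x = τ σ (τ σ' x) := by
    intro σ σ' x
    rw [hτ, hτ, hτ]
    induction x using TensorProduct.induction_on with
    | zero => simp
    | tmul b y => simp [Algebra.TensorProduct.map_tmul, AlgEquiv.mul_apply]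
    | add x y hx hy => simp only [map_add, hx, hy]
  let act : (K' ≃ₐ[K] K') →* RingAut (B ⊗[K] K') :=
    { toFun := fun σ => (τ σ).toRingEquiv
      map_one' := by ext x; exact hone x
      map_mul' := fun σ σ' => by ext x; exact hmul σ σ' x }
  have hact : ∀ (σ : K' ≃ₐ[K] K') (J : Ideal (B ⊗[K] K')),
      J.map (act σ : B ⊗[K] K' →+* B ⊗[K] K') = J.map (Algebra.TensorProduct.map (AlgHom.id B B) (σ : K' →ₐ[K] K')) := by
    intro σ J
    apply le_antisymm <;> rw [Ideal.map_le_iff_le_comap] <;> intro x hx <;> rw [Ideal.mem_comap]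
    · rw [show (act σ : B ⊗[K] K' →+* B ⊗[K] K') x = _ from hτ σ x]; exact Ideal.mem_map_of_mem _ hx
    · rw [← show (act σ : B ⊗[K] K' →+* B ⊗[K] K') x = _ from hτ σ x]; exact Ideal.mem_map_of_mem _ hx
  -- the orbit centre
  set J : Ideal (B ⊗[K] K') := ⨅ σ, I.map (act σ : B ⊗[K] K' →+* B ⊗[K] K') with hJ
  -- (a) «the piece depends only on the point»
  have hpt : ∀ σ ρ : K' ≃ₐ[K] K', 𝔔'.map (act σ : B ⊗[K] K' →+* B ⊗[K] K') = 𝔔'.map (act ρ : B ⊗[K] K' →+* B ⊗[K] K') →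
      I.map (act σ : B ⊗[K] K' →+* B ⊗[K] K') = I.map (act ρ : B ⊗[K] K' →+* B ⊗[K] K') := by
    -- first: stability under the stabiliser is an equality, then transport
    have hD' : ∀ δ : K' ≃ₐ[K] K', 𝔔'.map (act δ : B ⊗[K] K' →+* B ⊗[K] K') = 𝔔' → I.map (act δ : B ⊗[K] K' →+* B ⊗[K] K') = I := by
      intro δ hδ
      have hle : ∀ δ' : K' ≃ₐ[K] K', 𝔔'.map (act δ' : B ⊗[K] K' →+* B ⊗[K] K') = 𝔔' → I.map (act δ' : B ⊗[K] K' →+* B ⊗[K] K') ≤ I := by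
        intro δ' hδ'
        rw [hact]; exact hD δ' (by rw [← hact]; exact hδ')
      refine le_antisymm (hle δ hδ) ?_
      -- `I = δ (δ⁻¹ I) ≤ δ I` since `δ⁻¹` also stabilises `𝔔'`
      have hδ' : 𝔔'.map (act δ⁻¹ : B ⊗[K] K' →+* B ⊗[K] K') = 𝔔' := by
        have := congrArg (Ideal.map (act δ⁻¹ : B ⊗[K] K' →+* B ⊗[K] K')) hδ
        rw [BlowupOrbitCentre.map_map_act, inv_mul_cancel, map_one, h1id] at this
        exact this.symm
      have h2 := Ideal.map_mono (f := (act δ : B ⊗[K] K' →+* B ⊗[K] K')) (hle δ⁻¹ hδ')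
      rw [BlowupOrbitCentre.map_map_act, mul_inv_cancel, map_one, h1id] at h2
      exact h2
    intro σ ρ hσρ
    -- `ρ⁻¹ σ` stabilises `𝔔'`
    have h3 : 𝔔'.map (act (ρ⁻¹ * σ) : B ⊗[K] K' →+* B ⊗[K] K') = 𝔔' := by
      have := congrArg (Ideal.map (act ρ⁻¹ : B ⊗[K] K' →+* B ⊗[K] K')) hσρ
      rw [BlowupOrbitCentre.map_map_act, BlowupOrbitCentre.map_map_act, inv_mul_cancel, map_one] at this
      rw [this, h1id]
    have h4 := hD' (ρ⁻¹ * σ) h3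
    have := congrArg (Ideal.map (act ρ : B ⊗[K] K' →+* B ⊗[K] K')) h4
    rw [BlowupOrbitCentre.map_map_act, mul_inv_cancel_left] at this
    exact this
  -- (b) every point over `𝔭` is in the orbit of `𝔔'`; the others are regular
  have hoff' : ∀ x : Spec (.of (B ⊗[K] K')), (∀ σ : K' ≃ₐ[K] K', x.asIdeal ≠ 𝔔'.map (act σ : B ⊗[K] K' →+* B ⊗[K] K')) →
      x ∈ Scheme.regularLocus (Spec (.of (B ⊗[K] K'))) := by
    intro x hx
    refine hoff x fun hx𝔭 => ?_
    haveI : x.asIdeal.IsPrime := x.isPrime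
    obtain ⟨σ, hσ⟩ := GaloisTwistInvariants.exists_map_twist_eq_of_comap_eq 𝔔' x.asIdeal (h𝔔'𝔭.trans hx𝔭.symm)
    exact hx σ (hσ.trans (hact σ 𝔔').symm)
  -- (c) the orbit centre has regular blow-up and is Galois-stable
  have hregJ : Scheme.IsRegular (affineBlowup J) :=
    BlowupOrbitCentre.isRegular_affineBlowup_iInf_orbit act 𝔔' I hpI hIp hpt hoff' hreg
  have hGal : ∀ σ : K' ≃ₐ[K] K', ∀ x ∈ J,
      Algebra.TensorProduct.map (AlgHom.id B B) (σ : K' →ₐ[K] K') x ∈ J := by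
    intro σ x hx
    have h := Ideal.mem_map_of_mem (act σ : B ⊗[K] K' →+* B ⊗[K] K') hx
    rw [hJ, BlowupOrbitCentre.map_iInf_orbit_eq act I σ] at h
    rw [← hτ σ x]
    exact h
  -- (d) `𝔭ⁿ C ≤ J ≠ ⊤`
  have hJtop : J ≠ ⊤ := by
    intro htop
    have h1 : J ≤ I.map (act 1 : B ⊗[K] K' →+* B ⊗[K] K') := iInf_le _ 1
    rw [map_one, h1id, htop] at h1
    exact h𝔔'.ne_top (top_le_iff.mp (h1.trans hIp))
  have hpJ : (𝔭 ^ n).map (algebraMap B (B ⊗[K] K')) ≤ J := by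
    refine le_iInf fun σ => ?_
    -- `𝔭 C ≤ σ 𝔔'` because `σ 𝔔'` also lies over `𝔭`
    have h6 : 𝔭.map (algebraMap B (B ⊗[K] K')) ≤ 𝔔'.map (act σ : B ⊗[K] K' →+* B ⊗[K] K') := by
      rw [Ideal.map_le_iff_le_comap]
      intro b hb
      rw [Ideal.mem_comap, hact]
      have hb' : algebraMap B (B ⊗[K] K') b ∈ 𝔔' := by rw [← Ideal.mem_comap, h𝔔'𝔭]; exact hb
      rw [← (Algebra.TensorProduct.map (AlgHom.id B B) (σ : K' →ₐ[K] K')).commutes b]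
      exact Ideal.mem_map_of_mem _ hb'
    calc (𝔭 ^ n).map (algebraMap B (B ⊗[K] K')) = (𝔭.map (algebraMap B (B ⊗[K] K'))) ^ n := Ideal.map_pow _ _ _
      _ ≤ (𝔔'.map (act σ : B ⊗[K] K' →+* B ⊗[K] K')) ^ n := Ideal.pow_right_mono h6 n
      _ = (𝔔' ^ n).map (act σ : B ⊗[K] K' →+* B ⊗[K] K') := (Ideal.map_pow _ _ _).symm
      _ ≤ I.map (act σ : B ⊗[K] K' →+* B ⊗[K] K') := Ideal.map_mono hpI
  exact GaloisStableCentre.hloc_of_galois_stable_centre K X f ι hι 𝔭 h𝔭0 hsing hregB K' J hpJ hJtop hGal hregJ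

/-- **THE GALOIS ROUTE, SCHEME SIDE, ASSEMBLED.** Let `X` be an integral `K`-scheme locally of finite type (any field `K`) with
finitely many singular points. Suppose each singular point is `ι 𝔭` for an affine open `Spec B ↪ X` (`𝔭` maximal `≠ 0`,
`Spec B ∖ {𝔭}` regular) and carries: a finite Galois extension `K'/K` with `Spec(B ⊗_K K')` regular at the primes not over `𝔭`,
ONE maximal `𝔔'` of `B ⊗_K K'` over `𝔭`, and a `𝔔'`-primary piece `I` (`𝔔'ⁿ ⊆ I ⊆ 𝔔'`) stable under the decomposition group of
`𝔔'` whose blow-up is regular on some `D(g) ∋ 𝔔'`. Then `X` has a resolution of singularities.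
[cite: StacksProject, Tag 0CDQ; Tag 09EB] [cite: Kollar2007, §2.2] -/
theorem hasResolution_of_decomposition_stable_pieces (K : Type) [Field K] (X : Scheme.{0}) [IsIntegral X]
    (f : X ⟶ Spec (.of K)) [LocallyOfFiniteType f] (hfin : (Scheme.regularLocus X)ᶜ.Finite)
    (hchart : ∀ s : X, s ∉ Scheme.regularLocus X →
      ∃ (B : Type) (_ : CommRing B) (_ : IsDomain B) (_ : Algebra K B) (_ : Algebra.FiniteType K B)
        (ι : Spec (.of B) ⟶ X) (_ : IsOpenImmersion ι)
        (_ : ι ≫ f = Spec.map (CommRingCat.ofHom (algebraMap K B)))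
        (𝔭 : Ideal B) (h𝔭 : 𝔭.IsMaximal) (_ : 𝔭 ≠ ⊥) (_ : ι ⟨𝔭, h𝔭.isPrime⟩ = s)
        (_ : ∀ P : Spec (.of B), P.asIdeal ≠ 𝔭 → P ∈ Scheme.regularLocus (Spec (.of B)))
        (K' : Type) (_ : Field K') (_ : Algebra K K') (_ : FiniteDimensional K K') (_ : IsGalois K K')
        (_ : ∀ x : Spec (.of (B ⊗[K] K')), x.asIdeal.comap (algebraMap B (B ⊗[K] K')) ≠ 𝔭 →
          x ∈ Scheme.regularLocus (Spec (.of (B ⊗[K] K'))))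
        (𝔔' : Ideal (B ⊗[K] K')) (_ : 𝔔'.IsMaximal) (I : Ideal (B ⊗[K] K')) (n : ℕ),
          𝔔'.comap (algebraMap B (B ⊗[K] K')) = 𝔭 ∧ 𝔔' ^ n ≤ I ∧ I ≤ 𝔔' ∧
          (∀ σ : K' ≃ₐ[K] K',
            𝔔'.map (Algebra.TensorProduct.map (AlgHom.id B B) (σ : K' →ₐ[K] K')) = 𝔔' →
            I.map (Algebra.TensorProduct.map (AlgHom.id B B) (σ : K' →ₐ[K] K')) ≤ I) ∧
          ∃ g : B ⊗[K] K', g ∉ 𝔔' ∧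
            Scheme.IsRegular (affineBlowup (I.map (algebraMap (B ⊗[K] K') (Localization.Away g))))) :
    Scheme.HasResolution X := by
  refine IsolatedGlue.hasResolution_of_finite_singularLocus_of_local K X f hfin fun s hs => ?_
  obtain ⟨B, _, _, _, _, ι, _, hι, 𝔭, h𝔭, h𝔭0, hιs, hregB, K', _, _, _, _, hoff, 𝔔', _, I, n, h𝔔'𝔭, hpI, hIp, hD, hreg⟩ :=
    hchart s hs
  subst hιs
  exact hloc_of_decomposition_stable_piece K X f ι hι 𝔭 h𝔭0 hs hregB K' hoff 𝔔' h𝔔'𝔭 I hpI hIp hD hreg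

end Summit.ResolutionOfSingularities.ResolutionOfSingularities.Theorems.FRationalResolution.GaloisOrbitAssembly

end
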